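import Literature.Geometry.Riemannian.NormalExponentialMap
import Literature.Geometry.Riemannian.NormalExpGaussLemma
import Literature.Geometry.Lorentzian.CurveThroughVelocity
import HarnessLib

/-!
# Fermi coordinates of a hypersurface are semigeodesic (Lee 2018, Thm. 6.38 / Example 6.43)

Layer L1 of the proof programme of `Literature.Geometry.Riemannian.BaerHankePscGluing`
(Bär–Hanke 2023, §3, (7)–(8): in the collar given by the normal exponential map the metric is
`g = dt² + g_t` — the "generalized Gauss lemma"; Lee 2018, Example 6.44, boundary normal
coordinates). For a smooth pseudo-Riemannian metric `g` (Levi-Civita connection `C^∞`) on a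
Hausdorff manifold `M` without boundary, a map `ι : N → M` from a manifold with boundaryless
model and a field `ν` along `ι` with `z ↦ (ι z, ν z) ∈ TM` smooth, let
`E(z, t) = exp_{ι z}(t ν z)` be the normal exponential map (`NormalExponentialMap.lean`), defined
and `C^∞` on the open set `𝓓 = {(z, t) | t ∈ dom γ_{(ι z, ν z)}} ⊇ N × {0}`. Writing
`∂_t = dE_{(z,t)}(0, 1)` and `dE_{(z,t)}(w, 0)` for the images of the two factors of
`T_{(z,t)}(N × ℝ) = T_zN × ℝ`, we prove, for `(z, t) ∈ 𝓓`:

* `velocity_normalExp_right`, `velocity_normalExp_left` — chain rules: `∂_t` is the velocity of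
  the normal geodesic `t ↦ E(z, t)`, and `dE_{(z,t)}(σ'(s₀), 0)` is the velocity of
  `s ↦ E(σ s, t)` for a curve `σ` in `N`;
* `val_normalExp_dt_dt` — **`g(∂_t, ∂_t) = g(ν z, ν z)`** (constant speed of geodesics; `= 1` for
  a unit normal: Lee Prop. 6.41 (b) "`|∂_n|_g ≡ 1`");
* `val_normalExp_horizontal_dt` — **`g(dE_{(z,t)}(w, 0), ∂_t) = 0`** whenever `|ν|²_g` is
  constant on `N` and `ν z ⊥_g range dι_z` (Lee Thm. 6.38, Gauss lemma for submanifolds: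
  "`∂_r` is orthogonal to the level sets of `r`"; Prop. 6.41 (b) "`⟨∂_α, ∂_n⟩_g ≡ 0`") — from
  the variation form `val_velocity_normalVariation_eq_zero` (`NormalExpGaussLemma.lean`) applied
  to the variation `x(t, s) = E(σ s, t)` through the chart-straight curve `σ = curveThrough z w`,
  on a uniform strip around the segment `{z} × [0, t] ⊆ 𝓓` (generalized tube lemma);
* `val_mfderiv_normalExp` — **the semigeodesic form of the pulled-back metric**,
  `(E^*g)_{(z,t)}((w, a), (w', a')) = a a' g(ν z, ν z) + g(dE(w, 0), dE(w', 0))`, i.e.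
  `E^*g = |ν|² dt² + g_t` with `g_t = E(·, t)^*g` (Lee Cor. 6.42 (a):
  "`g = (dxⁿ)² + g_{αβ}(x¹, …, xⁿ) dx^α dx^β`"; Bär–Hanke (7)).

No definitions, no named facts (D-0026).

## References

* J. M. Lee, *Introduction to Riemannian Manifolds*, 2nd ed., GTM 176 (2018): Thm. 6.38 and its
  proof (p. 180), Prop. 6.41 (b), Cor. 6.42 (a), Examples 6.43–6.44. [LeeRiemannianManifolds2018]
* C. Bär, B. Hanke, *Boundary conditions for scalar curvature*, arXiv:2012.09127, §3, (7)–(8)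
  ("generalized Gauss lemma"). [BarHanke2023]
-/

noncomputable section

open Bundle Set Filter Function Metric
open scoped Manifold ContDiff Topology

namespace Literature.Geometry.Riemannian

open Literature.Geometry.Lorentzian
open Literature.Geometry.Lorentzian.PseudoRiemannianMetric

variable {E : Type*} [NormedAddCommGroup E] [NormedSpace ℝ E] {H : Type*} [TopologicalSpace H]
  {I : ModelWithCorners ℝ E H} {M : Type*} [TopologicalSpace M] [ChartedSpace H M]
  [IsManifold I ∞ M] [FiniteDimensional ℝ E] [CompleteSpace E] [T2Space M]
  [BoundarylessManifold I M]
  {E' : Type*} [NormedAddCommGroup E'] [NormedSpace ℝ E'] {H' : Type*} [TopologicalSpace H']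
  {I' : ModelWithCorners ℝ E' H'} {N : Type*} [TopologicalSpace N] [ChartedSpace H' N]
  {ι : N → M} {ν : Π z : N, TangentSpace I (ι z)}

/-! ### An open set containing a compact interval contains an open interval around it -/

omit [FiniteDimensional ℝ E] [CompleteSpace E] [T2Space M] [BoundarylessManifold I M] in
/-- If an open set `V ⊆ ℝ` contains `[min 0 t, max 0 t]` then it contains an open interval
`(a, b)` with `a < 0`, `0 < b` and `t ∈ (a, b)`. [folklore] -/
theorem exists_Ioo_subset_of_uIcc_subset {V : Set ℝ} (hV : IsOpen V) {t : ℝ}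
    (ht : uIcc 0 t ⊆ V) : ∃ a b : ℝ, a < 0 ∧ 0 < b ∧ t ∈ Ioo a b ∧ Ioo a b ⊆ V := by
  have hm : min 0 t ∈ V := ht ⟨le_rfl, min_le_max⟩
  have hM : max 0 t ∈ V := ht ⟨min_le_max, le_rfl⟩
  obtain ⟨δ₁, hδ₁, h₁⟩ := Metric.isOpen_iff.1 hV _ hm
  obtain ⟨δ₂, hδ₂, h₂⟩ := Metric.isOpen_iff.1 hV _ hM
  rw [Real.ball_eq_Ioo] at h₁ h₂
  refine ⟨min 0 t - δ₁, max 0 t + δ₂, by linarith [min_le_left 0 t],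
    by linarith [le_max_left 0 t], ⟨by linarith [min_le_right 0 t], by linarith [le_max_right 0 t]⟩,
    fun x hx ↦ ?_⟩
  rcases lt_or_ge x (min 0 t) with h | h
  · exact h₁ ⟨hx.1, by linarith⟩
  rcases le_or_gt x (max 0 t) with h' | h'
  · exact ht ⟨h, h'⟩
  · exact h₂ ⟨by linarith, hx.2⟩

/-! ### Chain rules for the two coordinate directions of `N × ℝ` -/

section ChainRules

variable {cov : CovariantDerivative I E (TangentSpace I : M → Type _)}

omit [CompleteSpace E] [T2Space M] [BoundarylessManifold I M] in
/-- **`∂_t E(z, t) = dE_{(z,t)}(0, 1)`**: the velocity of the normal geodesic `t ↦ E(z, t)` is the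
image of `(0, 1) ∈ T_zN × ℝ` (chain rule through `t ↦ (z, t)`, whose differential is the
inclusion of the second factor, `mfderiv_prod_right`). [folklore] -/
theorem velocity_normalExp_right {z : N} {t : ℝ}
    (hd : MDifferentiableAt (I'.prod 𝓘(ℝ, ℝ)) I
      (fun q : N × ℝ ↦ expMap cov (ι q.1) (q.2 • ν q.1)) (z, t)) :
    velocity I (fun t' : ℝ ↦ expMap cov (ι z) (t' • ν z)) t =
      mfderiv (I'.prod 𝓘(ℝ, ℝ)) I (fun q : N × ℝ ↦ expMap cov (ι q.1) (q.2 • ν q.1)) (z, t)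
        (((0 : TangentSpace I' z), (1 : ℝ)) : TangentSpace (I'.prod 𝓘(ℝ, ℝ)) (z, t)) := by
  have hc0 : MDifferentiableAt 𝓘(ℝ, ℝ) (I'.prod 𝓘(ℝ, ℝ)) (fun t' : ℝ ↦ ((z, t') : N × ℝ)) t :=
    mdifferentiableAt_const.prodMk mdifferentiableAt_id
  have hc : HasMFDerivAt 𝓘(ℝ, ℝ) (I'.prod 𝓘(ℝ, ℝ)) (fun t' : ℝ ↦ ((z, t') : N × ℝ)) t
      (ContinuousLinearMap.inr ℝ (TangentSpace I' z) (TangentSpace 𝓘(ℝ, ℝ) t)) := by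
    have h := hc0.hasMFDerivAt
    rwa [mfderiv_prod_right] at h
  have hcomp := hd.hasMFDerivAt.comp t hc
  have h2 : mfderiv 𝓘(ℝ, ℝ) I (fun t' : ℝ ↦ expMap cov (ι z) (t' • ν z)) t =
      (mfderiv (I'.prod 𝓘(ℝ, ℝ)) I (fun q : N × ℝ ↦ expMap cov (ι q.1) (q.2 • ν q.1)) (z, t)).comp
        (ContinuousLinearMap.inr ℝ (TangentSpace I' z) (TangentSpace 𝓘(ℝ, ℝ) t)) :=
    hcomp.mfderiv
  exact DFunLike.congr_fun h2 (1 : ℝ)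

omit [CompleteSpace E] [T2Space M] [BoundarylessManifold I M] in
/-- **`∂_s E(σ s, t) = dE_{(σ s, t)}(σ'(s), 0)`**: the velocity of `s ↦ E(σ s, t)` for a curve `σ`
in `N` differentiable at `s₀` (chain rule through `s ↦ (σ s, t)`). [folklore] -/
theorem velocity_normalExp_left {σ : ℝ → N} {s₀ t : ℝ}
    (hσ : MDifferentiableAt 𝓘(ℝ, ℝ) I' σ s₀)
    (hd : MDifferentiableAt (I'.prod 𝓘(ℝ, ℝ)) I
      (fun q : N × ℝ ↦ expMap cov (ι q.1) (q.2 • ν q.1)) (σ s₀, t)) :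
    velocity I (fun s : ℝ ↦ expMap cov (ι (σ s)) (t • ν (σ s))) s₀ =
      mfderiv (I'.prod 𝓘(ℝ, ℝ)) I (fun q : N × ℝ ↦ expMap cov (ι q.1) (q.2 • ν q.1)) (σ s₀, t)
        ((velocity I' σ s₀, (0 : ℝ)) : TangentSpace (I'.prod 𝓘(ℝ, ℝ)) (σ s₀, t)) := by
  have hc : HasMFDerivAt 𝓘(ℝ, ℝ) (I'.prod 𝓘(ℝ, ℝ)) (fun s : ℝ ↦ ((σ s, t) : N × ℝ)) s₀
      ((mfderiv 𝓘(ℝ, ℝ) I' σ s₀).prod (0 : TangentSpace 𝓘(ℝ, ℝ) s₀ →L[ℝ] TangentSpace 𝓘(ℝ, ℝ) t)) :=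
    hσ.hasMFDerivAt.prodMk (hasMFDerivAt_const t s₀)
  have hcomp := hd.hasMFDerivAt.comp s₀ hc
  have h2 : mfderiv 𝓘(ℝ, ℝ) I (fun s : ℝ ↦ expMap cov (ι (σ s)) (t • ν (σ s))) s₀ =
      (mfderiv (I'.prod 𝓘(ℝ, ℝ)) I (fun q : N × ℝ ↦ expMap cov (ι q.1) (q.2 • ν q.1))
        (σ s₀, t)).comp
        ((mfderiv 𝓘(ℝ, ℝ) I' σ s₀).prod
          (0 : TangentSpace 𝓘(ℝ, ℝ) s₀ →L[ℝ] TangentSpace 𝓘(ℝ, ℝ) t)) :=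
    hcomp.mfderiv
  exact DFunLike.congr_fun h2 (1 : ℝ)

end ChainRules

/-! ### Algebra: block form of a bilinear form from orthogonality of the last direction -/

omit [FiniteDimensional ℝ E] [CompleteSpace E] [T2Space M] [BoundarylessManifold I M] in
/-- If `L : V × ℝ → W` is linear, `G` is a bilinear form on `W` with `G(L(0,1), L(0,1)) = C`,
`G(L(w,0), L(0,1)) = 0` and `G(L(0,1), L(w',0)) = 0`, then
`G(L(w,a), L(w',a')) = a a' C + G(L(w,0), L(w',0))` (expand `(w, a) = (w, 0) + a (0, 1)`).
[folklore] -/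
theorem bilin_block_expand {V : Type*} [AddCommGroup V] [Module ℝ V] [TopologicalSpace V]
    {W : Type*} [AddCommGroup W] [Module ℝ W] [TopologicalSpace W]
    (L : V × ℝ →L[ℝ] W) (G : W →L[ℝ] W →L[ℝ] ℝ) (w w' : V) (a a' : ℝ) {C : ℝ}
    (hTT : G (L (0, 1)) (L (0, 1)) = C) (hXT : G (L (w, 0)) (L (0, 1)) = 0)
    (hTX' : G (L (0, 1)) (L (w', 0)) = 0) :
    G (L (w, a)) (L (w', a')) = a * a' * C + G (L (w, 0)) (L (w', 0)) := by
  have hdec : ∀ (u : V) (c : ℝ), ((u, c) : V × ℝ) = (u, 0) + c • ((0 : V), (1 : ℝ)) := by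
    intro u c
    ext
    · simp
    · simp
  rw [hdec w a, hdec w' a']
  simp only [map_add, map_smul, add_apply, smul_apply, smul_eq_mul]
  rw [hTT, hXT, hTX']
  ring

/-! ### Semigeodesic form of `E^* g` -/

section Semigeodesic

variable {n : ℕ∞ω} [Fact (1 ≤ n)] (g : PseudoRiemannianMetric I n E (TangentSpace I : M → Type _))
  [g.HasLeviCivita]
  [CovariantDerivative.ContMDiffCovariantDerivative g.leviCivita 1]
  [CovariantDerivative.ContMDiffCovariantDerivative g.leviCivita ((⊤ : ℕ∞) : ℕ∞ω)]

/-- **`g(∂_t, ∂_t) = g(ν z, ν z)` along the normal geodesics** (Lee Prop. 6.41 (b), first half,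
for `|ν| = 1`): for `(z, t) ∈ 𝓓`, with `∂_t = dE_{(z,t)}(0, 1)`.
[cite: LeeRiemannianManifolds2018, Prop. 6.41 (b) / Thm. 6.38] -/
theorem val_normalExp_dt_dt
    (hν : ContMDiff I' I.tangent ∞ (fun z ↦ (TotalSpace.mk' E (ι z) (ν z) : TangentBundle I M)))
    {z : N} {t : ℝ} (ht : t ∈ maximalGeodesicDomain g.leviCivita (ι z) (ν z)) :
    g.val (expMap g.leviCivita (ι z) (t • ν z))
        (mfderiv (I'.prod 𝓘(ℝ, ℝ)) I
          (fun q : N × ℝ ↦ expMap g.leviCivita (ι q.1) (q.2 • ν q.1)) (z, t)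
          (((0 : TangentSpace I' z), (1 : ℝ)) : TangentSpace (I'.prod 𝓘(ℝ, ℝ)) (z, t)))
        (mfderiv (I'.prod 𝓘(ℝ, ℝ)) I
          (fun q : N × ℝ ↦ expMap g.leviCivita (ι q.1) (q.2 • ν q.1)) (z, t)
          (((0 : TangentSpace I' z), (1 : ℝ)) : TangentSpace (I'.prod 𝓘(ℝ, ℝ)) (z, t))) =
      g.val (ι z) (ν z) (ν z) := by
  have hd : MDifferentiableAt (I'.prod 𝓘(ℝ, ℝ)) I
      (fun q : N × ℝ ↦ expMap g.leviCivita (ι q.1) (q.2 • ν q.1)) (z, t) :=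
    (contMDiffAt_normalExp (cov := g.leviCivita) (k := (⊤ : ℕ∞)) le_top hν ht).mdifferentiableAt
      (by simp)
  rw [← velocity_normalExp_right hd]
  exact val_velocity_normalVariation_self g (c := fun _ : ℝ ↦ ι z) (fun _ ↦ ν z) 0 ht

variable [I'.Boundaryless] [IsManifold I' ∞ N]

/-- **The Gauss lemma for the normal exponential map: `g(dE_{(z,t)}(w, 0), ∂_t) = 0`** (Lee 2018,
Thm. 6.38; Prop. 6.41 (b), second half). Hypotheses: `|ν|²_g` is constant on `N`
(`g(ν z', ν z') = g(ν z, ν z)`), `ν z` is `g`-orthogonal to `range dι_z`, and `(z, t) ∈ 𝓓`.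
Proof: the variation `x(t', s) = E(σ s, t')` through the chart-straight curve `σ` with
`σ(0) = z`, `σ'(0) = w` is defined on a uniform strip `(a, b) × (-ε, ε)` around the segment
`{z} × [0, t] ⊆ 𝓓` (generalized tube lemma), and `val_velocity_normalVariation_eq_zero` gives
`g(∂_s x, ∂_t x)(t, 0) = 0`; finally `∂_s x(t, 0) = dE_{(z,t)}(w, 0)` and `∂_t x(t, 0) = ∂_t`
(chain rules). [cite: LeeRiemannianManifolds2018, Thm. 6.38] -/
theorem val_normalExp_horizontal_dt
    (hν : ContMDiff I' I.tangent ∞ (fun z ↦ (TotalSpace.mk' E (ι z) (ν z) : TangentBundle I M)))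
    {z : N} (hVV : ∀ z' : N, g.val (ι z') (ν z') (ν z') = g.val (ι z) (ν z) (ν z))
    (hperp : ∀ w : TangentSpace I' z, g.val (ι z) (mfderiv I' I ι z w) (ν z) = 0)
    {t : ℝ} (ht : t ∈ maximalGeodesicDomain g.leviCivita (ι z) (ν z)) (w : TangentSpace I' z) :
    g.val (expMap g.leviCivita (ι z) (t • ν z))
        (mfderiv (I'.prod 𝓘(ℝ, ℝ)) I
          (fun q : N × ℝ ↦ expMap g.leviCivita (ι q.1) (q.2 • ν q.1)) (z, t)
          ((w, (0 : ℝ)) : TangentSpace (I'.prod 𝓘(ℝ, ℝ)) (z, t)))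
        (mfderiv (I'.prod 𝓘(ℝ, ℝ)) I
          (fun q : N × ℝ ↦ expMap g.leviCivita (ι q.1) (q.2 • ν q.1)) (z, t)
          (((0 : TangentSpace I' z), (1 : ℝ)) : TangentSpace (I'.prod 𝓘(ℝ, ℝ)) (z, t))) = 0 := by
  set NE : N × ℝ → M := fun q ↦ expMap g.leviCivita (ι q.1) (q.2 • ν q.1) with hNE
  set D : Set (N × ℝ) := {q | q.2 ∈ maximalGeodesicDomain g.leviCivita (ι q.1) (ν q.1)} with hD
  have hDo : IsOpen D := isOpen_normalExpDomain (cov := g.leviCivita) (k := (⊤ : ℕ∞)) le_top hν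
  have hNEs : ContMDiffOn (I'.prod 𝓘(ℝ, ℝ)) I ∞ NE D :=
    contMDiffOn_normalExp (cov := g.leviCivita) (k := (⊤ : ℕ∞)) le_top hν
  -- `ι` is smooth
  have hιs : ContMDiff I' I ∞ ι := by
    have h := (Bundle.contMDiff_proj (TangentSpace I : M → Type _)).comp hν
    exact h
  -- the segment `{z} × [0, t]` lies in `D`
  obtain ⟨hmax, h0, -, -⟩ := maximalGeodesic_spec' (cov := g.leviCivita) (ι z) (ν z)
  have hseg : ({z} : Set N) ×ˢ uIcc (0 : ℝ) t ⊆ D := by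
    rintro ⟨z', t'⟩ ⟨hz', ht'⟩
    rw [mem_singleton_iff] at hz'
    subst hz'
    exact hmax.2.1.uIcc_subset h0 ht ht'
  obtain ⟨U, V, hUo, hVo, hzU, htV, hUV⟩ :=
    generalized_tube_lemma isCompact_singleton isCompact_uIcc hDo hseg
  rw [singleton_subset_iff] at hzU
  obtain ⟨a, b, ha, hb, htab, hV⟩ := exists_Ioo_subset_of_uIcc_subset hVo htV
  -- the chart-straight curve `σ` through `z` with velocity `w`, and a good parameter interval
  set σ : ℝ → N := curveThrough I' z w with hσ_def
  have hσ0 : σ 0 = z := curveThrough_zero I' z w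
  have hev₁ : ∀ᶠ s in 𝓝 (0 : ℝ), σ s ∈ U := by
    have hc : ContinuousAt σ 0 := (contMDiffAt_curveThrough_zero (n := ∞) z w).continuousAt
    rw [← hσ0] at hzU
    exact hc.preimage_mem_nhds (hUo.mem_nhds hzU)
  have hev₂ : ∀ᶠ s in 𝓝 (0 : ℝ),
      extChartAt I' z z + s • (show E' from w) ∈ (extChartAt I' z).target := by
    have hc : Continuous (fun s : ℝ ↦ extChartAt I' z z + s • (show E' from w)) :=
      continuous_const.add (continuous_id.smul continuous_const)
    have h0 : extChartAt I' z z + (0 : ℝ) • (show E' from w) ∈ (extChartAt I' z).target := by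
      rw [zero_smul, add_zero]
      exact mem_extChartAt_target z
    exact hc.continuousAt.preimage_mem_nhds ((isOpen_extChartAt_target z).mem_nhds h0)
  obtain ⟨ε, hε, hball⟩ := Metric.eventually_nhds_iff_ball.1 (hev₁.and hev₂)
  have hI : ∀ s ∈ Ioo (-ε) ε, σ s ∈ U ∧
      extChartAt I' z z + s • (show E' from w) ∈ (extChartAt I' z).target := by
    intro s hs
    apply hball
    rw [Real.ball_eq_Ioo, zero_sub, zero_add]
    exact hs
  have hσs : ∀ s ∈ Ioo (-ε) ε, ContMDiffAt 𝓘(ℝ, ℝ) I' ∞ σ s :=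
    fun s hs ↦ contMDiffAt_curveThrough z w (hI s hs).2
  -- hypotheses of the variation form
  have hcV : ∀ s ∈ Ioo (-ε) ε, ContMDiffAt 𝓘(ℝ, ℝ) I.tangent ∞
      (fun s ↦ (TotalSpace.mk' E ((ι ∘ σ) s) (ν (σ s)) : TangentBundle I M)) s :=
    fun s hs ↦ (hν (σ s)).comp s (hσs s hs)
  have hstrip : ∀ t' ∈ Ioo a b, ∀ s ∈ Ioo (-ε) ε,
      t' ∈ maximalGeodesicDomain g.leviCivita ((ι ∘ σ) s) (ν (σ s)) :=
    fun t' ht' s hs ↦ hUV (mk_mem_prod (hI s hs).1 (hV ht'))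
  have hVV' : ∀ s ∈ Ioo (-ε) ε,
      g.val ((ι ∘ σ) s) (ν (σ s)) (ν (σ s)) = g.val ((ι ∘ σ) 0) (ν (σ 0)) (ν (σ 0)) :=
    fun s _ ↦ (hVV (σ s)).trans (hVV (σ 0)).symm
  have hσd : MDifferentiableAt 𝓘(ℝ, ℝ) I' σ 0 :=
    (contMDiffAt_curveThrough_zero (n := ∞) z w).mdifferentiableAt (by simp)
  have hιd : MDifferentiableAt I' I ι (σ 0) := (hιs (σ 0)).mdifferentiableAt (by simp)
  have hvel : velocity I (ι ∘ σ) 0 = mfderiv I' I ι (σ 0) (velocity I' σ 0) := by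
    simp only [velocity]
    rw [mfderiv_comp 0 hιd hσd]
    rfl
  have hσv : velocity I' σ 0 = w :=
    velocity_curveThrough_zero_holds BoundarylessManifold.isInteriorPoint w
  have key₀ : ∀ y : N, y = z → ∀ u : TangentSpace I' y, g.val (ι y) (mfderiv I' I ι y u) (ν y) = 0 := by
    rintro y rfl u
    exact hperp u
  have hperp' : g.val ((ι ∘ σ) 0) (velocity I (ι ∘ σ) 0) (ν (σ 0)) = 0 := by
    rw [hvel]
    exact key₀ (σ 0) hσ0 (velocity I' σ 0)
  -- the variation form of the Gauss lemma
  have key := val_velocity_normalVariation_eq_zero_of_mem_maximalGeodesicDomain g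
    (k := (⊤ : ℕ∞)) rfl (c := ι ∘ σ) (V := fun s ↦ ν (σ s)) hε ha hb hcV hstrip hVV' hperp' htab
  -- identify the two velocities with `dE (σ' 0, 0)` and `dE (0, 1)` at `(σ 0, t)`
  have htD : (σ 0, t) ∈ D := by
    show t ∈ maximalGeodesicDomain g.leviCivita (ι (σ 0)) (ν (σ 0))
    exact hstrip t htab 0 ⟨by linarith, hε⟩
  have hd : MDifferentiableAt (I'.prod 𝓘(ℝ, ℝ)) I NE (σ 0, t) :=
    ((hNEs _ htD).contMDiffAt (hDo.mem_nhds htD)).mdifferentiableAt (by simp)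
  have h1 : velocity I (fun s : ℝ ↦ expMap g.leviCivita ((ι ∘ σ) s) (t • ν (σ s))) 0 =
      mfderiv (I'.prod 𝓘(ℝ, ℝ)) I NE (σ 0, t)
        ((velocity I' σ 0, (0 : ℝ)) : TangentSpace (I'.prod 𝓘(ℝ, ℝ)) (σ 0, t)) :=
    velocity_normalExp_left (cov := g.leviCivita) hσd hd
  have h2 : velocity I (fun t' : ℝ ↦ expMap g.leviCivita ((ι ∘ σ) 0) (t' • ν (σ 0))) t =
      mfderiv (I'.prod 𝓘(ℝ, ℝ)) I NE (σ 0, t)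
        (((0 : TangentSpace I' (σ 0)), (1 : ℝ)) : TangentSpace (I'.prod 𝓘(ℝ, ℝ)) (σ 0, t)) :=
    velocity_normalExp_right (cov := g.leviCivita) hd
  -- replace the two velocities by differentials of `E`
  have keyT : ∀ (p : M) (S₁ T₁ S₂ T₂ : TangentSpace I p), S₁ = S₂ → T₁ = T₂ →
      g.val p S₁ T₁ = 0 → g.val p S₂ T₂ = 0 := by
    rintro p S₁ T₁ S₂ T₂ rfl rfl h
    exact h
  have key₂ : g.val (expMap g.leviCivita (ι (σ 0)) (t • ν (σ 0)))
      (mfderiv (I'.prod 𝓘(ℝ, ℝ)) I NE (σ 0, t)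
        ((velocity I' σ 0, (0 : ℝ)) : TangentSpace (I'.prod 𝓘(ℝ, ℝ)) (σ 0, t)))
      (mfderiv (I'.prod 𝓘(ℝ, ℝ)) I NE (σ 0, t)
        (((0 : TangentSpace I' (σ 0)), (1 : ℝ)) : TangentSpace (I'.prod 𝓘(ℝ, ℝ)) (σ 0, t))) = 0 :=
    keyT _ _ _ _ _ h1 h2 key
  -- transport from `σ 0` to `z`
  have final : ∀ y : N, y = z → ∀ u : TangentSpace I' y, u = w →
      g.val (expMap g.leviCivita (ι y) (t • ν y))
        (mfderiv (I'.prod 𝓘(ℝ, ℝ)) I NE (y, t)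
          ((u, (0 : ℝ)) : TangentSpace (I'.prod 𝓘(ℝ, ℝ)) (y, t)))
        (mfderiv (I'.prod 𝓘(ℝ, ℝ)) I NE (y, t)
          (((0 : TangentSpace I' y), (1 : ℝ)) : TangentSpace (I'.prod 𝓘(ℝ, ℝ)) (y, t))) = 0 →
      g.val (expMap g.leviCivita (ι z) (t • ν z))
        (mfderiv (I'.prod 𝓘(ℝ, ℝ)) I NE (z, t)
          ((w, (0 : ℝ)) : TangentSpace (I'.prod 𝓘(ℝ, ℝ)) (z, t)))
        (mfderiv (I'.prod 𝓘(ℝ, ℝ)) I NE (z, t)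
          (((0 : TangentSpace I' z), (1 : ℝ)) : TangentSpace (I'.prod 𝓘(ℝ, ℝ)) (z, t))) = 0 := by
    rintro y rfl u rfl h
    exact h
  exact final (σ 0) hσ0 (velocity I' σ 0) hσv key₂

/-- **Semigeodesic form of the pulled-back metric** (Lee 2018, Cor. 6.42 (a) with Example 6.43;
Bär–Hanke 2023, (7): `g = dt² + g_t`): under the hypotheses of `val_normalExp_horizontal_dt`,
for all `(w, a), (w', a') ∈ T_zN × ℝ`,
`g(dE(w, a), dE(w', a')) = a a' g(ν z, ν z) + g(dE(w, 0), dE(w', 0))` — the pulled-back metric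
`E^*g` on `𝓓 ⊆ N × ℝ` is `|ν|² dt² + g_t` with `g_t = E(·, t)^* g` and no cross terms.
[cite: LeeRiemannianManifolds2018, Cor. 6.42 (a)] -/
theorem val_mfderiv_normalExp
    (hν : ContMDiff I' I.tangent ∞ (fun z ↦ (TotalSpace.mk' E (ι z) (ν z) : TangentBundle I M)))
    {z : N} (hVV : ∀ z' : N, g.val (ι z') (ν z') (ν z') = g.val (ι z) (ν z) (ν z))
    (hperp : ∀ w : TangentSpace I' z, g.val (ι z) (mfderiv I' I ι z w) (ν z) = 0)
    {t : ℝ} (ht : t ∈ maximalGeodesicDomain g.leviCivita (ι z) (ν z))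
    (w w' : TangentSpace I' z) (a a' : ℝ) :
    g.val (expMap g.leviCivita (ι z) (t • ν z))
        (mfderiv (I'.prod 𝓘(ℝ, ℝ)) I
          (fun q : N × ℝ ↦ expMap g.leviCivita (ι q.1) (q.2 • ν q.1)) (z, t)
          ((w, a) : TangentSpace (I'.prod 𝓘(ℝ, ℝ)) (z, t)))
        (mfderiv (I'.prod 𝓘(ℝ, ℝ)) I
          (fun q : N × ℝ ↦ expMap g.leviCivita (ι q.1) (q.2 • ν q.1)) (z, t)
          ((w', a') : TangentSpace (I'.prod 𝓘(ℝ, ℝ)) (z, t))) =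
      a * a' * g.val (ι z) (ν z) (ν z) +
        g.val (expMap g.leviCivita (ι z) (t • ν z))
          (mfderiv (I'.prod 𝓘(ℝ, ℝ)) I
            (fun q : N × ℝ ↦ expMap g.leviCivita (ι q.1) (q.2 • ν q.1)) (z, t)
            ((w, (0 : ℝ)) : TangentSpace (I'.prod 𝓘(ℝ, ℝ)) (z, t)))
          (mfderiv (I'.prod 𝓘(ℝ, ℝ)) I
            (fun q : N × ℝ ↦ expMap g.leviCivita (ι q.1) (q.2 • ν q.1)) (z, t)
            ((w', (0 : ℝ)) : TangentSpace (I'.prod 𝓘(ℝ, ℝ)) (z, t))) := by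
  exact bilin_block_expand (V := E') (W := E)
    (mfderiv (I'.prod 𝓘(ℝ, ℝ)) I
      (fun q : N × ℝ ↦ expMap g.leviCivita (ι q.1) (q.2 • ν q.1)) (z, t))
    (g.val (expMap g.leviCivita (ι z) (t • ν z))) w w' a a'
    (val_normalExp_dt_dt g hν ht) (val_normalExp_horizontal_dt g hν hVV hperp ht w)
    ((g.symm _ _ _).trans (val_normalExp_horizontal_dt g hν hVV hperp ht w'))

end Semigeodesic

end Literature.Geometry.Riemannian
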